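import Summits.FinalStateConjecture.FinalStateConjecture.Theses.PhaseMixingCapture
import Summits.FinalStateConjecture.FinalStateConjecture.Theorems.SwallowTheDatumKerrShieldedSettlesStubCollarEmbedsMGHDAux
import Literature.Geometry.Lorentzian.CauchyDevelopmentRestrict
import Literature.Geometry.Lorentzian.DataEmbeddingNormalSmooth
import Literature.Geometry.Lorentzian.InitialDataPullback
import Literature.Geometry.Lorentzian.KerrDataProofs
import HarnessLib

/-!
# Crux `PhaseMixingCapture.WeakCosmicCensorshipMGHD` (stmt-FinalStateConjecture-9952), line
# `scri-transfer-third-of-burial`, stub `stub_collarRealisation` (plumbing adapter)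

**The tapered collar is a vacuum Cauchy development of the exterior sub-datum, realised inside
exact Kerr.**  Let the datum `D` on `X` be Kerr-shielded by `(M, a, r₁, φ, ψ, ν)`: sub-extremal
`(M, a)`, window `r₋ < r₁ < r₊`, `φ : Kerr.slice a r₁ → X` a smooth open embedding with compact
complement of its range, `ψ` the graph of the bent height `T = bentHeight M a` over the slice
(spacelike, future unit normal `ν`), with the pull-back identities `φ^* h = ψ^* g_{M,a}` and
`φ^* k = K_ν(ψ)`.  Granted the collar Cauchy property (the bent leaf `{x⁰ = T(r)}` is met exactly
once by every endless future-timelike chart curve of the tapered collar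
`W = {0 < x⁰ − T(r x) + (r x − r₁)/4}`) and `Ric(g_{M,a}) = 0` on the chart, the map `φ` is
`C^{∞+1}` with injective differentials and the pulled-back datum `φ^* D` has a vacuum Cauchy
development `𝒦` together with a smooth, time-orientation preserving, isometric open embedding
`j : 𝒦 → Kerr.region a r₁` over the bent slice (`j ∘ ι_𝒦 = ψ`, `dj ν_𝒦 = ν`) whose range contains
the whole tapered collar.

Proof (plumbing, after the sibling crux `KerrShieldedSettles`, stub S3 `stub_collarEmbedsMGHD`):
`ψ = graph M a r₁` (`psi_eq_graph`) is a smooth embedding (`isSmoothEmbedding_graph`); `dφ` is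
injective (`injective_mfderiv_of_inner_eq`); the shield is a `DataEmbedding` of `φ^* D` into
`Kerr.spacetime M a r₁ hM`; restricting it (`DataEmbedding.restrict`) to the open connected collar
`W ⊇ ψ(slice)` (`collar`, `isConnected_collar`, `graph_mem_collar`) gives a vacuum Cauchy
development (`isCauchyHypersurface_collar`, `isRicciFlat_restrict`); `j := Subtype.val` is the
inclusion `W ⊆ Kerr.region a r₁`, smooth with identity differential (`mfderiv_subtypeVal`), an open
embedding with range `W`.

References: J. Sbierski, Ann. Henri Poincaré 17 (2016), Def. 2.4, §3.1; H. Ringström, *The Cauchy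
problem in General Relativity* (2009), Def. 16.5; Y. Choquet-Bruhat, R. Geroch, CMP 14 (1969),
p. 332; M. Dafermos, I. Rodnianski, arXiv:0811.0354, §5.1.
-/

set_option linter.dupNamespace false

noncomputable section

open scoped Manifold ContDiff Topology
open Set Function Topology Literature.Geometry.Lorentzian
open Summit.FinalStateConjecture.FinalStateConjecture.Theorems.KerrShieldedDataExist.Negative
  (bentHeight bentHeight_eq_literal graph psi_eq_graph mass_pos)
open Summit.FinalStateConjecture.FinalStateConjecture.Theorems.SwallowTheDatum.KerrShieldedSettles.CollarEmbedsMGHD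
  (collar isSmoothEmbedding_graph isConnected_collar graph_mem_collar injective_mfderiv_of_inner_eq
    isCauchyHypersurface_collar)

namespace Summit.FinalStateConjecture.FinalStateConjecture.Theorems.PhaseMixingCapture.WeakCosmicCensorshipMGHD

/-- The Kerr–Schild slices are connected spaces (theorem `Kerr.isConnected_slice_holds`); used as a
local instance, needed to speak of developments of data on the slice. [folklore] -/
private theorem connectedSpace_kerrSlice (a r₀ : ℝ) : ConnectedSpace (Kerr.slice a r₀) :=
  isConnected_iff_connectedSpace.mp (Kerr.isConnected_slice_holds a r₀)

attribute [local instance] connectedSpace_kerrSlice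

/-- **Stub `stub_collarRealisation` — the tapered collar is a vacuum Cauchy development of the
exterior sub-datum, realised in exact Kerr with the collar in its range** (line
`scri-transfer-third-of-burial` of crux `stmt-FinalStateConjecture-9952`).  For a Kerr-shielded
datum (first hypothesis, the shielding predicate unfolded), granted the collar Cauchy property
(second hypothesis) and `Ric(g_{M,a}) = 0` on the chart (third hypothesis): `φ` is `C^{∞+1}` with
injective differentials (`φ^* h = ψ^* g` is positive definite, `injective_mfderiv_of_inner_eq`), and
`φ^* D` has the vacuum Cauchy development `𝒦 :=` the shield's data embedding
`(Kerr.spacetime M a r₁ hM, ψ = graph M a r₁, ν)` restricted to the open connected tapered collar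
`W ⊇ ψ(slice)` (`DataEmbedding.restrict`, `isCauchyHypersurface_collar`, `isRicciFlat_restrict`),
realised by the inclusion `j := Subtype.val : W → Kerr.region a r₁` — smooth, an open embedding,
isometric and time-orientation preserving because `dj = id` (`mfderiv_subtypeVal`), with
`j ∘ ι_𝒦 = ψ`, `dj ν_𝒦 = ν` by construction and `range j = W`.
[cite: Sbierski2016AHP, Def. 2.4] [cite: Ringstrom2009, Def. 16.5] -/
theorem stub_collarRealisation : ∀ [Kerr.Facts] (X : Type) [TopologicalSpace X] [ChartedSpace E3 X]
    [IsManifold (𝓡 3) ∞ X] [T2Space X] [SecondCountableTopology X] [ConnectedSpace X]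
    (D : InitialDataSet (𝓡 3) X) (M a r₁ : ℝ) (hM : 0 ≤ M) (φ : Kerr.slice a r₁ → X)
    (ψ : Kerr.slice a r₁ → Kerr.region a r₁) (ν : NormalField 𝓘(ℝ, E4) ψ), (|a| < M ∧
    Kerr.rMinus M a < r₁ ∧ r₁ < Kerr.rPlus M a ∧ IsCompact (Set.range φ)ᶜ ∧
    Topology.IsOpenEmbedding φ ∧ ContMDiff 𝓘(ℝ, E3) (𝓡 3) ∞ φ ∧ (∀ y : Kerr.slice a r₁, (ψ y : E4) =
    E4.ofTimeSpace (bentHeight M a (Kerr.radius a (E4.ofTimeSpace 0 (y : E3)))) (y : E3)) ∧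
    (Kerr.smoothMetric M a r₁).IsSpacelikeImmersion 𝓘(ℝ, E3) ψ ∧
    (Kerr.smoothMetric M a r₁).IsFutureUnitNormal 𝓘(ℝ, E3) ((Kerr.timeOrientation M a r₁ hM).ofLE
    le_top) ψ ν ∧ (∀ y : Kerr.slice a r₁, pullbackBilin (I := 𝓡 3) (I' := 𝓘(ℝ, E3)) φ D.h.inner y =
    pullbackBilin (I := 𝓘(ℝ, E4)) (I' := 𝓘(ℝ, E3)) ψ (Kerr.smoothMetric M a r₁).val y) ∧
    (∀ [(Kerr.smoothMetric M a r₁).HasLeviCivita] (y : Kerr.slice a r₁),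
    (pullbackBilin (I := 𝓡 3) (I' := 𝓘(ℝ, E3)) φ D.k y).toLinearMap₁₂ =
    (Kerr.smoothMetric M a r₁).secondFundamentalForm 𝓘(ℝ, E3) ψ ν y)) →
    (∀ (γ : ℝ → Kerr.region a r₁) (s : Set ℝ), s.OrdConnected → s.Nonempty →
    (Kerr.smoothMetric M a r₁).IsFutureTimelikeCurveOn ((Kerr.timeOrientation M a r₁ hM).ofLE le_top)
    γ s → (∀ t ∈ s, 0 < (γ t : E4) 0 - bentHeight M a (Kerr.radius a (γ t : E4)) +
    (Kerr.radius a (γ t : E4) - r₁) / 4) → (∀ q : Kerr.region a r₁, 0 < (q : E4) 0 -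
    bentHeight M a (Kerr.radius a (q : E4)) + (Kerr.radius a (q : E4) - r₁) / 4 →
    ¬ HasFutureEndpoint γ s q ∧ ¬ HasPastEndpoint γ s q) →
    ∃! t, t ∈ s ∧ (γ t : E4) 0 = bentHeight M a (Kerr.radius a (γ t : E4))) →
    Kerr.isRicciFlat M a r₁ → ∃ (hΦ : ContMDiff (𝓡 3) (𝓡 3) (∞ + 1) φ)
    (hΦ' : ∀ u, Function.Injective (mfderiv (𝓡 3) (𝓡 3) φ u))
    (𝒦 : VacuumCauchyDevelopment (D.comap φ hΦ hΦ')) (j : 𝒦.carrier → Kerr.region a r₁),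
    (ContMDiff (𝓡 4) 𝓘(ℝ, E4) ∞ j ∧ Topology.IsOpenEmbedding j ∧
    𝒦.metric.IsIsometricImmersion (Kerr.smoothMetric M a r₁).toPseudoRiemannianMetric j ∧
    𝒦.timeOrientation.PreservesTimeOrientation j ((Kerr.timeOrientation M a r₁ hM).ofLE le_top) ∧
    j ∘ 𝒦.embed = ψ ∧
    (∀ y : Kerr.slice a r₁, mfderiv (𝓡 4) 𝓘(ℝ, E4) j (𝒦.embed y) (𝒦.normal y) = ν y) ∧
    {x : Kerr.region a r₁ | 0 < (x : E4) 0 - bentHeight M a (Kerr.radius a (x : E4)) +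
    (Kerr.radius a (x : E4) - r₁) / 4} ⊆ Set.range j) := by
  intro _ X _ _ _ _ _ _ D M a r₁ hM φ ψ ν hS hC hRic
  obtain ⟨ha, -, -, -, -, hφs, hψ, hsp, hν, hh, hk⟩ := hS
  -- the graph clause pins `ψ` to the explicit leaf
  obtain rfl : ψ = graph M a r₁ := psi_eq_graph rfl hψ
  have hM0 : 0 < M := mass_pos ha
  -- the pull-back identity `φ^* h = ψ^* g`, applied to a pair of vectors
  have hh' : ∀ (y : Kerr.slice a r₁) (v w : E3),
      D.h.inner (φ y) (mfderiv 𝓘(ℝ, E3) (𝓡 3) φ y v) (mfderiv 𝓘(ℝ, E3) (𝓡 3) φ y w) =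
        Kerr.bilin M a (graph M a r₁ y : E4) (mfderiv 𝓘(ℝ, E3) 𝓘(ℝ, E4) (graph M a r₁) y v)
          (mfderiv 𝓘(ℝ, E3) 𝓘(ℝ, E4) (graph M a r₁) y w) := fun y v w ↦ by
    have h := congrArg (fun B ↦ B v w) (hh y)
    simp only [pullbackBilin_apply] at h
    exact h
  -- smoothness degree `∞ + 1 = ∞` and injectivity of `dφ`
  have hφ1 : ContMDiff (𝓡 3) (𝓡 3) (∞ + 1) φ := hφs
  have hφ' : ∀ u, Function.Injective (mfderiv (𝓡 3) (𝓡 3) φ u) :=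
    injective_mfderiv_of_inner_eq D hsp hh'
  -- the exact slice data and the data embedding of the shield into the whole chart
  let Dₑ : InitialDataSet (𝓡 3) (Kerr.slice a r₁) := D.comap φ hφ1 hφ'
  let 𝒮K : DataEmbedding Dₑ :=
    { toSpacetime := Kerr.spacetime M a r₁ hM
      embed := graph M a r₁
      isSmoothEmbedding := isSmoothEmbedding_graph hM0 a r₁
      normal := ν
      isFutureUnitNormal := hν
      induced_h := fun y ↦ by
        ext v w
        exact (hh' y v w).symm
      induced_k := by
        intro instLC y
        haveI : (Kerr.smoothMetric M a r₁).HasLeviCivita := instLC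
        exact (hk y).symm }
  have hvac : 𝒮K.IsVacuum := by
    intro instLC x
    haveI : (Kerr.metric M a r₁).HasLeviCivita := instLC
    exact hRic x
  -- restriction to the collar: a vacuum Cauchy development of the exact slice data
  have hW : IsConnected (collar M a r₁ hM0 : Set (Kerr.region a r₁)) := isConnected_collar hM0
  have hι : ∀ y, 𝒮K.embed y ∈ collar M a r₁ hM0 := graph_mem_collar hM0
  let 𝒲 : VacuumCauchyDevelopment Dₑ :=
    { toDataEmbedding := 𝒮K.restrict (collar M a r₁ hM0) hW hι 𝒮K.mdifferentiableAt_embed_normal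
      isCauchyHypersurface := isCauchyHypersurface_collar hM hM0 hC
      isRicciFlat := by
        intro instLC
        haveI : (𝒮K.metric.restrict PseudoRiemannianMetric.contMDiff_restrict_holds
            (collar M a r₁ hM0)).toPseudoRiemannianMetric.HasLeviCivita := instLC
        exact 𝒮K.isRicciFlat_restrict (collar M a r₁ hM0) hvac }
  -- the realisation: `𝒦 := 𝒲`, `j :=` the inclusion of the collar in the chart
  refine ⟨hφ1, hφ', 𝒲, Subtype.val, contMDiff_subtype_val,
    (collar M a r₁ hM0).2.isOpenEmbedding_subtypeVal, ⟨contMDiff_subtype_val, fun p ↦ ?_⟩,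
    fun p ↦ ?_, rfl, fun y ↦ ?_, fun x hx ↦ ⟨⟨x, hx⟩, rfl⟩⟩
  · -- isometric: `(g|_W)_p = g_p` and `dj = id`
    ext v w
    change (Kerr.smoothMetric M a r₁).val p.1
        (mfderiv (𝓡 4) (𝓡 4) (Subtype.val : collar M a r₁ hM0 → Kerr.region a r₁) p v)
        (mfderiv (𝓡 4) (𝓡 4) (Subtype.val : collar M a r₁ hM0 → Kerr.region a r₁) p w) =
      (Kerr.smoothMetric M a r₁).val p.1 v w
    rw [mfderiv_subtypeVal]
    rfl
  · -- time-orientation preserving: `dj V = V`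
    change 𝒮K.timeOrientation.IsFutureDirected
      (mfderiv (𝓡 4) (𝓡 4) (Subtype.val : collar M a r₁ hM0 → Kerr.region a r₁) p
        (𝒮K.timeOrientation.vectorField p.1))
    rw [mfderiv_subtypeVal]
    exact 𝒮K.timeOrientation.isFutureDirected_vectorField p.1
  · -- `dj ν_𝒦 = ν`
    change mfderiv (𝓡 4) (𝓡 4) (Subtype.val : collar M a r₁ hM0 → Kerr.region a r₁)
        ⟨graph M a r₁ y, hι y⟩ (ν y) = ν y
    rw [mfderiv_subtypeVal]
    rfl

end Summit.FinalStateConjecture.FinalStateConjecture.Theorems.PhaseMixingCapture.WeakCosmicCensorshipMGHD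

end
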